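import Literature.AlgebraicGeometry.Deformation.SmoothSchemeLiftObstructionCriterionGlueLineBundleCocycle
import Literature.AlgebraicGeometry.Modules.MatrixCocycleFrame
import Literature.AlgebraicGeometry.Modules.RankOneCocycle
import HarnessLib

/-!
# Gluing the lifted charts, VI-b: the rank-one module on the glued deformation defined by an exact twisted unit cocycle
# (Hartshorne, *Deformation Theory*, Thm. 6.4 (a) in the gluing dialect of Thm. 10.2; *Algebraic Geometry* II Ex. 5.18 (b))

Layer `Literature/AlgebraicGeometry/Deformation` (cell `hodgecm-mathlib`, F-11 sub-line `F11SmoothRoadA`, α1 grandchild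
`F11LiftWithLineBundle`, stub G2 dictionary D1; FILE 2 of 2; THEOREMS ONLY — no definition, no instance, no notation, no named fact).
Sequel of `Deformation/SmoothSchemeLiftObstructionCriterionGlueLineBundleCocycle` (same `variable`s VERBATIM: closed fibre `X/Spec k`,
coefficients `R ⊇ 𝔫`, principal affine cover `U`, cocycle-exact lifted gluing data `ψ`, glued deformation
`X' := (deformationGlueDatum …).glueData.glued` with charts `ι j : C j ⟶ X'`; lifted transition units `G j l` with the twisted cocycle
identity `hGcoc`; their overlap sections `g_{jl}` characterised by their chart-`j` reading `Λ_{jl} (G j l)`).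

* `isUnit_overlapSection` — the `g_{jl}` are units; `overlapSection_self` — `g_{jj} = 1` (an idempotent unit, by the cocycle at `(j,j,j)`).
* **`exists_rankOne_frames_of_twistedCocycle`** — THE HEAD: there is an `𝒪_{X'}`-module `L` with `HasRank L 1` and frames
  `e_j : 𝒪 ≅ L|_{ι j (C j)}` on the chart images whose transition functions are the `g_{jl}`: `T(e_j, e_l) = (g_{jl}|_V)` over every
  `V ⊆ ι j (C j) ∩ ι l (C l)` (★ `Modules.transition`; equivalently `e_l = g_{jl} • e_j`).  It is ★ `Modules.MatrixCocycle.glued` of the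
  rank-one matrix cocycle `(ι j (C j), (g_{jl}))` with its ★ frames `MatrixCocycle.frame` (transition matrices ★ `transition_frame`,
  local freeness ★ `isFiniteLocallyFree_glued`; the charts cover `X'` by Mathlib `Scheme.GlueData.ι_jointly_surjective`), `HasRank 1` by
  the frame system of ★ `Modules.FrameSystem.hasRank`.  Rigidification of `L` along a section from `Spec` of a LOCAL ring is free:
  ★ `Modules/CechPicOfLocalRing.CechPic.pullback_eq_one_of_isLocalRing` (not restated).

Consumer (G2 assembler of `Cruxes/HDel/Lines/F11LiftWithLineBundle`): with `R := A` Artinian local, `ψ := ψ₂` the MOVED gluing data and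
`G` the corrected units of `Deformation/PairLiftObstructionMove.exact_correctedUnits_of_move`, `L` is the invertible sheaf `L₂` on the
moved lift `X₂ = Glue_A(ψ₂)`; its pull-back along the reduction `Glue_{A⧸J}(φ) ⟶ Glue_A(ψ₂)` is computed frame by frame
(★ `Modules/PullbackFrame.transition_pullbackFrame` + ★ `Modules/IsoOfFramesMatrix.nonempty_iso_of_framesMatrix`).
HC_CM is proved only modulo the 7 printed citations until rung 0 closes — nothing here bears on a summit statement.

## References
* [Hartshorne1977] R. Hartshorne, *Algebraic Geometry*, GTM 52 (1977): II Ex. 1.22, II Ex. 5.18 (b) (locally free sheaves and their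
  isomorphisms from transition data), III Ex. 4.5.
* [Hartshorne2010] R. Hartshorne, *Deformation Theory*, GTM 257, Springer (2010): Thm. 6.4 (a) and its proof (pp. 50–51); Thm. 10.2 (a)
  proof (p. 81).
* [StacksProject] The Stacks Project, Tag 01JA (glueing schemes), Tag 00AK (glueing sheaves).
-/

noncomputable section

-- `TopCat.Presheaf`/`TopCat.Sheaf` are not reducible (as in Mathlib's `AlgebraicGeometry/Modules`).
set_option backward.isDefEq.respectTransparency false

open CategoryTheory AlgebraicGeometry Opposite TopologicalSpace Limits
open scoped TensorProduct

universe u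

namespace Literature.AlgebraicGeometry.Deformation

section D1A2

open Literature.AlgebraicGeometry.Motives Literature.AlgebraicGeometry.Morphisms Literature.AlgebraicGeometry.Modules

variable {k : Type u} [Field k] {X : Over (Spec (CommRingCat.of k))}
  [instΓ : ∀ W : X.left.Opens, Algebra k Γ(X.left, W)]
  (halg : ∀ (W : X.left.Opens) (s : k), algebraMap k Γ(X.left, W) s = (constToPresheaf X).app (op W) s)
  (R : Type u) [CommRing R] [Algebra k R]
  {ι : Type u} (U : ι → X.left.affineOpens) (b : (j l : ι) → Γ(X.left, (U j).1))
  (hb : ∀ j l, (U j).1 ⊓ (U l).1 = X.left.basicOpen (b j l))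
  (ψ : (j l : ι) → R ⊗[k] Γ(X.left, (U j).1 ⊓ (U l).1) ≃ₐ[R] R ⊗[k] Γ(X.left, (U j).1 ⊓ (U l).1))
  (𝔫 : Ideal R) (h𝔫 : IsNilpotent 𝔫)
  (hψ : ∀ j l x, ψ j l x - x ∈ 𝔫 • (⊤ : Submodule R (R ⊗[k] Γ(X.left, (U j).1 ⊓ (U l).1))))
  (hcoc : ∀ (j l m : ι)
    (Φjl : R ⊗[k] Γ(X.left, (U j).1 ⊓ (U l).1) →ₐ[R] R ⊗[k] Γ(X.left, (U j).1 ⊓ (U l).1 ⊓ (U m).1))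
    (_ : ∀ a s, Φjl (a ⊗ₜ s) = a ⊗ₜ X.left.presheaf.map (homOfLE inf_le_left).op s)
    (Φlm : R ⊗[k] Γ(X.left, (U l).1 ⊓ (U m).1) →ₐ[R] R ⊗[k] Γ(X.left, (U j).1 ⊓ (U l).1 ⊓ (U m).1))
    (_ : ∀ a s, Φlm (a ⊗ₜ s) = a ⊗ₜ X.left.presheaf.map
      (homOfLE (le_inf (inf_le_left.trans inf_le_right) inf_le_right)).op s)
    (Φjm : R ⊗[k] Γ(X.left, (U j).1 ⊓ (U m).1) →ₐ[R] R ⊗[k] Γ(X.left, (U j).1 ⊓ (U l).1 ⊓ (U m).1))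
    (_ : ∀ a s, Φjm (a ⊗ₜ s) = a ⊗ₜ X.left.presheaf.map
      (homOfLE (le_inf (inf_le_left.trans inf_le_left) inf_le_right)).op s)
    (ρjl ρlm ρjm : R ⊗[k] Γ(X.left, (U j).1 ⊓ (U l).1 ⊓ (U m).1) ≃ₐ[R]
      R ⊗[k] Γ(X.left, (U j).1 ⊓ (U l).1 ⊓ (U m).1)),
    (∀ x, ρjl (Φjl x) = Φjl (ψ j l x)) → (∀ x, ρlm (Φlm x) = Φlm (ψ l m x)) →
    (∀ x, ρjm (Φjm x) = Φjm (ψ j m x)) → ρlm * ρjl = ρjm)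

variable (G : (j l : ι) → R ⊗[k] Γ(X.left, (U j).1 ⊓ (U l).1))

variable
  (hGcoc : ∀ (j l m : ι)
    (Φjl : R ⊗[k] Γ(X.left, (U j).1 ⊓ (U l).1) →ₐ[R] R ⊗[k] Γ(X.left, (U j).1 ⊓ (U l).1 ⊓ (U m).1))
    (_ : ∀ a s, Φjl (a ⊗ₜ s) = a ⊗ₜ X.left.presheaf.map (homOfLE inf_le_left).op s)
    (Φlm : R ⊗[k] Γ(X.left, (U l).1 ⊓ (U m).1) →ₐ[R] R ⊗[k] Γ(X.left, (U j).1 ⊓ (U l).1 ⊓ (U m).1))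
    (_ : ∀ a s, Φlm (a ⊗ₜ s) = a ⊗ₜ X.left.presheaf.map
      (homOfLE (le_inf (inf_le_left.trans inf_le_right) inf_le_right)).op s)
    (Φjm : R ⊗[k] Γ(X.left, (U j).1 ⊓ (U m).1) →ₐ[R] R ⊗[k] Γ(X.left, (U j).1 ⊓ (U l).1 ⊓ (U m).1))
    (_ : ∀ a s, Φjm (a ⊗ₜ s) = a ⊗ₜ X.left.presheaf.map
      (homOfLE (le_inf (inf_le_left.trans inf_le_left) inf_le_right)).op s)
    (τjl : R ⊗[k] Γ(X.left, (U j).1 ⊓ (U l).1 ⊓ (U m).1) ≃ₐ[R] R ⊗[k] Γ(X.left, (U j).1 ⊓ (U l).1 ⊓ (U m).1)),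
    (∀ x, τjl (Φjl (ψ j l x)) = Φjl x) → Φjm (G j m) = Φjl (G j l) * τjl (Φlm (G l m)))

include hb h𝔫 hψ in
/-- The overlap sections of UNITS `G j l` are units. [cite: Hartshorne1977, II Ex. 5.18 (b)] -/
theorem isUnit_overlapSection (hGu : ∀ j l, IsUnit (G j l))
    (s : (j l : ι) →
      Γ((deformationGlueDatum halg R U b hb ψ 𝔫 h𝔫 hψ hcoc).glueData.glued,
        ((deformationGlueDatum halg R U b hb ψ 𝔫 h𝔫 hψ hcoc).glueData.ι j).opensRange ⊓
          ((deformationGlueDatum halg R U b hb ψ 𝔫 h𝔫 hψ hcoc).glueData.ι l).opensRange))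
    (hs : ∀ j l, ((chartOverlap R U j l).ι ≫ (deformationGlueDatum halg R U b hb ψ 𝔫 h𝔫 hψ hcoc).glueData.ι j).appLE
        (((deformationGlueDatum halg R U b hb ψ 𝔫 h𝔫 hψ hcoc).glueData.ι j).opensRange ⊓
          ((deformationGlueDatum halg R U b hb ψ 𝔫 h𝔫 hψ hcoc).glueData.ι l).opensRange) ⊤
        (top_le_preimage_opensRange_inf halg R U b hb ψ 𝔫 h𝔫 hψ hcoc j l) (s j l) =
      overlapRingHom halg R U j l (G j l))
    (j l : ι) : IsUnit (s j l) := by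
  haveI := isIso_appLE_top_of_opensRange_eq _ _ (opensRange_overlap_ι_comp_ι halg R U b hb ψ 𝔫 h𝔫 hψ hcoc j l)
    (top_le_preimage_opensRange_inf halg R U b hb ψ 𝔫 h𝔫 hψ hcoc j l)
  have h := (hGu j l).map (overlapRingHom halg R U j l)
  rw [← hs j l] at h
  have h' : IsUnit ((asIso (((chartOverlap R U j l).ι ≫
      (deformationGlueDatum halg R U b hb ψ 𝔫 h𝔫 hψ hcoc).glueData.ι j).appLE
        (((deformationGlueDatum halg R U b hb ψ 𝔫 h𝔫 hψ hcoc).glueData.ι j).opensRange ⊓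
          ((deformationGlueDatum halg R U b hb ψ 𝔫 h𝔫 hψ hcoc).glueData.ι l).opensRange) ⊤
        (top_le_preimage_opensRange_inf halg R U b hb ψ 𝔫 h𝔫 hψ hcoc j l))).commRingCatIsoToRingEquiv (s j l)) := h
  exact (isUnit_map_iff _ _).mp h'

include hb h𝔫 hψ hGcoc in
/-- The diagonal overlap sections are `1` (`g_{jj} = 1`: an idempotent unit, by the cocycle at `(j, j, j)`).
[cite: Hartshorne1977, II Ex. 5.18 (b)] -/
theorem overlapSection_self (hGu : ∀ j l, IsUnit (G j l))
    (s : (j l : ι) →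
      Γ((deformationGlueDatum halg R U b hb ψ 𝔫 h𝔫 hψ hcoc).glueData.glued,
        ((deformationGlueDatum halg R U b hb ψ 𝔫 h𝔫 hψ hcoc).glueData.ι j).opensRange ⊓
          ((deformationGlueDatum halg R U b hb ψ 𝔫 h𝔫 hψ hcoc).glueData.ι l).opensRange))
    (hs : ∀ j l, ((chartOverlap R U j l).ι ≫ (deformationGlueDatum halg R U b hb ψ 𝔫 h𝔫 hψ hcoc).glueData.ι j).appLE
        (((deformationGlueDatum halg R U b hb ψ 𝔫 h𝔫 hψ hcoc).glueData.ι j).opensRange ⊓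
          ((deformationGlueDatum halg R U b hb ψ 𝔫 h𝔫 hψ hcoc).glueData.ι l).opensRange) ⊤
        (top_le_preimage_opensRange_inf halg R U b hb ψ 𝔫 h𝔫 hψ hcoc j l) (s j l) =
      overlapRingHom halg R U j l (G j l))
    (j : ι) : s j j = 1 := by
  have hmul := overlapSection_mul halg R U b hb ψ 𝔫 h𝔫 hψ hcoc G hGcoc s hs j j j
  have hle : ((deformationGlueDatum halg R U b hb ψ 𝔫 h𝔫 hψ hcoc).glueData.ι j).opensRange ⊓
      ((deformationGlueDatum halg R U b hb ψ 𝔫 h𝔫 hψ hcoc).glueData.ι j).opensRange ⊓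
      ((deformationGlueDatum halg R U b hb ψ 𝔫 h𝔫 hψ hcoc).glueData.ι j).opensRange ≤
      ((deformationGlueDatum halg R U b hb ψ 𝔫 h𝔫 hψ hcoc).glueData.ι j).opensRange ⊓
      ((deformationGlueDatum halg R U b hb ψ 𝔫 h𝔫 hψ hcoc).glueData.ι j).opensRange := inf_le_left
  change secRes _ hle (s j j) * secRes _ hle (s j j) = secRes _ hle (s j j) at hmul
  have hu : IsUnit (secRes _ hle (s j j)) :=
    (isUnit_overlapSection halg R U b hb ψ 𝔫 h𝔫 hψ hcoc G hGu s hs j j).map _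
  have h1 : secRes _ hle (s j j) = 1 := hu.mul_left_cancel (hmul.trans (mul_one _).symm)
  -- restriction to the (equal) triple intersection is injective
  have heq : ((deformationGlueDatum halg R U b hb ψ 𝔫 h𝔫 hψ hcoc).glueData.ι j).opensRange ⊓
      ((deformationGlueDatum halg R U b hb ψ 𝔫 h𝔫 hψ hcoc).glueData.ι j).opensRange ⊓
      ((deformationGlueDatum halg R U b hb ψ 𝔫 h𝔫 hψ hcoc).glueData.ι j).opensRange =
      ((deformationGlueDatum halg R U b hb ψ 𝔫 h𝔫 hψ hcoc).glueData.ι j).opensRange ⊓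
      ((deformationGlueDatum halg R U b hb ψ 𝔫 h𝔫 hψ hcoc).glueData.ι j).opensRange := by
    rw [inf_idem, inf_idem]
  have hh : (homOfLE hle) = (eqToIso heq).hom := Subsingleton.elim _ _
  haveI : IsIso ((deformationGlueDatum halg R U b hb ψ 𝔫 h𝔫 hψ hcoc).glueData.glued.presheaf.map
      (homOfLE hle).op) := by
    rw [hh]
    infer_instance
  have hinj : Function.Injective (secRes (deformationGlueDatum halg R U b hb ψ 𝔫 h𝔫 hψ hcoc).glueData.glued hle) :=
    (ConcreteCategory.bijective_of_isIso
      ((deformationGlueDatum halg R U b hb ψ 𝔫 h𝔫 hψ hcoc).glueData.glued.presheaf.map (homOfLE hle).op)).1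
  apply hinj
  rw [h1, map_one]

/-! ## §3 The rank-one module with frames on the chart images and transition functions the `g_{jl}` -/

include hb h𝔫 hψ hGcoc in
/-- **THE RANK-ONE MODULE GLUED FROM AN EXACT TWISTED UNIT COCYCLE.**  For units `G j l ∈ R ⊗_k Γ(U j ∩ U l)`
satisfying the twisted cocycle identity w.r.t. the cocycle-exact lifted gluing data `ψ`, and `g_{jl}` their overlap
sections on the glued deformation `X' = Glue_R(ψ)` (§1), there is an `𝒪_{X'}`-module `L` of RANK ONE with frames
`e_j : 𝒪 ≅ L|_{ι j (C j)}` on the chart images whose TRANSITION FUNCTIONS are the `g_{jl}`: over every open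
`V ⊆ ι j (C j) ∩ ι l (C l)`, `T(e_j, e_l) = (g_{jl}|_V)` (the `1 × 1` matrix; i.e. `e_l = g_{jl} e_j`).  It is the module
glued from the trivial rank-one modules on the charts along the `g_{jl}` (Hartshorne II Ex. 1.22 / II Ex. 5.18; in the
tree ★ `Modules.MatrixCocycle.glued` with its frames ★ `MatrixCocycle.frame` and ★ `transition_frame`); in the deformation
reading ([Hartshorne2010] Thm. 6.4 (a)) it is the invertible sheaf on the lifted scheme defined by lifted transition
functions that glue.  Rigidification along any section from `Spec` of a local ring is free: ★
`Modules/CechPicOfLocalRing.CechPic.pullback_eq_one_of_isLocalRing`.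
[cite: Hartshorne1977, II Ex. 5.18 (b)] [cite: Hartshorne2010, Thm. 6.4 (a) (proof, pp. 50–51)] [cite: StacksProject, Tag 01JA] -/
theorem exists_rankOne_frames_of_twistedCocycle (hGu : ∀ j l, IsUnit (G j l))
    (s : (j l : ι) →
      Γ((deformationGlueDatum halg R U b hb ψ 𝔫 h𝔫 hψ hcoc).glueData.glued,
        ((deformationGlueDatum halg R U b hb ψ 𝔫 h𝔫 hψ hcoc).glueData.ι j).opensRange ⊓
          ((deformationGlueDatum halg R U b hb ψ 𝔫 h𝔫 hψ hcoc).glueData.ι l).opensRange))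
    (hs : ∀ j l, ((chartOverlap R U j l).ι ≫ (deformationGlueDatum halg R U b hb ψ 𝔫 h𝔫 hψ hcoc).glueData.ι j).appLE
        (((deformationGlueDatum halg R U b hb ψ 𝔫 h𝔫 hψ hcoc).glueData.ι j).opensRange ⊓
          ((deformationGlueDatum halg R U b hb ψ 𝔫 h𝔫 hψ hcoc).glueData.ι l).opensRange) ⊤
        (top_le_preimage_opensRange_inf halg R U b hb ψ 𝔫 h𝔫 hψ hcoc j l) (s j l) =
      overlapRingHom halg R U j l (G j l)) :
    ∃ (L : (deformationGlueDatum halg R U b hb ψ 𝔫 h𝔫 hψ hcoc).glueData.glued.Modules) (_ : HasRank L 1)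
      (e : ∀ j, SheafOfModules.free (PUnit : Type u) ≅
        L.over ((deformationGlueDatum halg R U b hb ψ 𝔫 h𝔫 hψ hcoc).glueData.ι j).opensRange),
      ∀ (j l : ι) (V : (deformationGlueDatum halg R U b hb ψ 𝔫 h𝔫 hψ hcoc).glueData.glued.Opens)
        (hj : V ≤ ((deformationGlueDatum halg R U b hb ψ 𝔫 h𝔫 hψ hcoc).glueData.ι j).opensRange)
        (hl : V ≤ ((deformationGlueDatum halg R U b hb ψ 𝔫 h𝔫 hψ hcoc).glueData.ι l).opensRange),
        transition (e j) (e l) (homOfLE hj) (homOfLE hl) =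
          Matrix.of fun _ _ => secRes (deformationGlueDatum halg R U b hb ψ 𝔫 h𝔫 hψ hcoc).glueData.glued
            (le_inf hj hl) (s j l) := by
  -- the rank-one matrix cocycle on the chart images
  let c : MatrixCocycle (deformationGlueDatum halg R U b hb ψ 𝔫 h𝔫 hψ hcoc).glueData.glued ι :=
    { U := fun j => ((deformationGlueDatum halg R U b hb ψ 𝔫 h𝔫 hψ hcoc).glueData.ι j).opensRange
      I := fun _ => PUnit
      g := fun j l V hj hl => Matrix.of fun _ _ =>
        secRes (deformationGlueDatum halg R U b hb ψ 𝔫 h𝔫 hψ hcoc).glueData.glued (le_inf hj hl) (s j l)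
      map_g := fun j l V V' hj hl i => by
        ext ⟨⟩ ⟨⟩
        rw [Matrix.map_apply, Matrix.of_apply, Matrix.of_apply, secRes_secRes]
      g_mul := fun j l m V hj hl hm => by
        ext ⟨⟩ ⟨⟩
        simp only [Matrix.mul_apply, Matrix.of_apply, Finset.univ_unique, Finset.sum_singleton]
        have h3 := congrArg (secRes (deformationGlueDatum halg R U b hb ψ 𝔫 h𝔫 hψ hcoc).glueData.glued
          (le_inf (le_inf hj hl) hm)) (overlapSection_mul halg R U b hb ψ 𝔫 h𝔫 hψ hcoc G hGcoc s hs j l m)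
        rw [map_mul, secRes_secRes, secRes_secRes, secRes_secRes] at h3
        exact h3
      g_self := fun j V hj => by
        ext ⟨⟩ ⟨⟩
        rw [Matrix.of_apply, Matrix.one_apply_eq, overlapSection_self halg R U b hb ψ 𝔫 h𝔫 hψ hcoc G hGcoc hGu s hs j,
          map_one] }
  have hcov : ∀ x : ↥((deformationGlueDatum halg R U b hb ψ 𝔫 h𝔫 hψ hcoc).glueData.glued), ∃ j, x ∈ c.U j :=
    fun x => by
      obtain ⟨j, y, hy⟩ := (deformationGlueDatum halg R U b hb ψ 𝔫 h𝔫 hψ hcoc).glueData.ι_jointly_surjective x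
      exact ⟨j, ⟨y, hy⟩⟩
  choose jx hjx using hcov
  let F : FrameSystem c.glued :=
    { U := fun x => c.U (jx x)
      mem := hjx
      I := fun _ => PUnit
      rank := fun _ => 1
      enum := fun _ => Fintype.equivFinOfCardEq rfl
      frame := fun x => c.frame (jx x) }
  exact ⟨c.glued, F.hasRank 1 fun _ => rfl, fun j => c.frame j, fun j l V hj hl =>
    c.transition_frame j l (homOfLE hj) (homOfLE hl)⟩

end D1A2

end Literature.AlgebraicGeometry.Deformation

end
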